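import Mathlib
import HarnessLib
import Summits.ValiantsHypothesis.ValiantsHypothesis.Theorems.LacunarySymmetroidMatrixDescartesProductPlusOneSplitSignedK
import Summits.ValiantsHypothesis.ValiantsHypothesis.Theorems.LacunarySymmetroidMatrixDescartesProductPlusOneSplitSignedKMonotone

/-!
# ValiantsHypothesis / LacunarySymmetroid — crux `MatrixDescartes` (stmt-ValiantsHypothesis-18050, V1),
# LINE (A) «product_plus_one»: every-`K` WINDOW LAW at a NEAR-END coupling (one exponent below the coupled letter)

Every-`K` twin of the `K = 3` middle-coupling type-β window law ✓ `eulerNumeratorMiddle_roots_Icc_le_one_of_letterSumTwo_neg`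
(`…ProductPlusOneABWindowMiddle`, M1 + M3).  Setting: rows `f_j = Σ_l C a_{jl} X^{d_l}` (ANY `K`, ANY support), coupled letter `l₀`,
SPLIT-SIGNED rows (letters below the coupled exponent `≥ 0`, above `≤ 0`), and the NEAR-END hypothesis: every exponent below `d_{l₀}` equals
`d_{l₀} − g` for one gap `g > 0` (one lower EXPONENT — several lower letters may share it; e.g. `l₀` = the second-lowest letter of a sorted
support; `K = 3`, `l₀ = 1` is the middle coupling).  On a window `[u,v] ⊂ (0,∞)` on which every row keeps a constant sign (ahead `f_j > 0` or
passed `f_j < 0`):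

* `inv_row_monotone_of_splitSigned` — `x ↦ x^{d_{l₀}}/f_j(x)` is ISOTONE on the window (from ✓ `splitSigned_row_cross_le`), hence the
  LETTER-FRACTION SUMS `A_l(x) = Σ_j a_{jl}·x^{d_{l₀}}/f_j(x)` are isotone for lower letters (`a_{jl} ≥ 0`) and antitone for upper letters
  (`a_{jl} ≤ 0`) — the every-`K` form of M1 (`letterSumsMiddle_monotone`);
* `eulerNumeratorK_eval_eq_prod_mul_sum` — off the poles `R_{l₀}(x) = P(x)·Σ_j B_j(x)/f_j(x)`;
* ★★ `eulerNumeratorK_roots_Icc_le_one_of_upperSums_neg` — THE WINDOW LAW: if on `[u,v]` every UPPER letter-fraction sum is negative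
  (`A_l(x) < 0` for `d_l > d_{l₀}`; «the ahead rows dominate every upper letter»), then the c-free Euler numerator `R_{l₀}` has AT MOST ONE
  zero in `[u,v]` — because `x^g·Σ_j B_j/f_j = −g·Σ_{lower} A_l(x) + Σ_{upper} (d_l − d_{l₀})·x^{d_l + g − d_{l₀}}·A_l(x)` is STRICTLY antitone
  there.  (For `K = 3`, `l₀ = 1` this is M3 with `A₂ < 0`; for `K ≥ 4` it is the first window law at an interior coupling.  When BOTH sides of
  the coupled letter carry several exponents no such law is available by this mechanism: the weight `x^g` can straighten only one side.)

HONEST FRAMING: a window law (type-β windows) for the every-`K` near-end interior coupling of the research stubs `stub_polyLaw` / `stub_eulerBoundK3`;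
the count on the remaining (type-α) windows is the research content and is NOT touched; closes NO stub by name; NOT `OneChangeFloorK3`, `EulerBoundK3`,
`ClassRowK3Linear`, `PPOPolyLaw`, `ProductPlusOneMDR`, `MatrixDescartes`; `VP ≠ VNP` is NOT proved.  No definitions, no named facts, no sorry.

[folklore] Elementary monotonicity bookkeeping; no citation needed.
-/

set_option linter.dupNamespace false

namespace Summit.ValiantsHypothesis.ValiantsHypothesis.Theorems.LacunarySymmetroidMatrixDescartes

namespace ProductPlusOne

open Polynomial Finset
open scoped BigOperators

/-! ### §1 The inverse reduced row is isotone on a constant-sign window -/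

/-- **`x ↦ x^{d_{l₀}}/f(x)` is isotone** on `[u,v] ⊂ (0,∞)` for a split-signed row of constant sign there. [folklore] -/
theorem inv_row_monotone_of_splitSigned {K : ℕ} (d : Fin K → ℕ) (b : Fin K → ℝ) (l₀ : Fin K)
    (hlow : ∀ l, d l < d l₀ → 0 ≤ b l) (hup : ∀ l, d l₀ < d l → b l ≤ 0) {u v : ℝ} (hu : 0 < u)
    (hsign : (∀ x ∈ Set.Icc u v, 0 < (∑ l, C (b l) * X ^ (d l) : ℝ[X]).eval x) ∨
      (∀ x ∈ Set.Icc u v, (∑ l, C (b l) * X ^ (d l) : ℝ[X]).eval x < 0)) :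
    MonotoneOn (fun x => x ^ (d l₀) / (∑ l, C (b l) * X ^ (d l) : ℝ[X]).eval x) (Set.Icc u v) := by
  intro x hx y hy hxy
  have hx0 : 0 < x := hu.trans_le hx.1
  have hcross := splitSigned_row_cross_le d b l₀ hlow hup hx0 hxy
  -- `f(x)·f(y) > 0` in both sign cases
  have hprod : 0 < (∑ l, C (b l) * X ^ (d l) : ℝ[X]).eval x * (∑ l, C (b l) * X ^ (d l) : ℝ[X]).eval y := by
    rcases hsign with h | h
    · exact mul_pos (h x hx) (h y hy)
    · exact mul_pos_of_neg_of_neg (h x hx) (h y hy)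
  have hfx : (∑ l, C (b l) * X ^ (d l) : ℝ[X]).eval x ≠ 0 := by
    intro h0; rw [h0, zero_mul] at hprod; exact lt_irrefl _ hprod
  have hfy : (∑ l, C (b l) * X ^ (d l) : ℝ[X]).eval y ≠ 0 := by
    intro h0; rw [h0, mul_zero] at hprod; exact lt_irrefl _ hprod
  show x ^ (d l₀) / (∑ l, C (b l) * X ^ (d l) : ℝ[X]).eval x ≤ y ^ (d l₀) / (∑ l, C (b l) * X ^ (d l) : ℝ[X]).eval y
  rw [← sub_nonneg, div_sub_div _ _ hfy hfx]
  refine div_nonneg ?_ ?_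
  · -- `y^N f(x) − f(y) x^N ≥ 0`
    linarith
  · rw [mul_comm]; exact hprod.le

/-! ### §2 Off the poles `R_{l₀} = P · Σ_j B_j/f_j` -/

/-- Off the poles, `R_{l₀}(x) = P(x) · Σ_j B_j(x)/f_j(x)`. [folklore] -/
theorem eulerNumeratorK_eval_eq_prod_mul_sum {m K : ℕ} (d : Fin K → ℕ) (a : Fin m → Fin K → ℝ) (l₀ : Fin K) {x : ℝ}
    (hpole : ∀ i, (∑ l, C (a i l) * X ^ (d l) : ℝ[X]).eval x ≠ 0) :
    ((∑ j, (∑ l, C (a j l * ((d l : ℝ) - d l₀)) * X ^ (d l)) * ∏ i ∈ Finset.univ.erase j, (∑ l, C (a i l) * X ^ (d l))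
        : ℝ[X]).eval x)
      = (∏ i, (∑ l, C (a i l) * X ^ (d l) : ℝ[X]).eval x) *
          ∑ j, (∑ l, C (a j l * ((d l : ℝ) - d l₀)) * X ^ (d l) : ℝ[X]).eval x / (∑ l, C (a j l) * X ^ (d l) : ℝ[X]).eval x := by
  classical
  rw [eulerNumeratorK_eval_eq, Finset.mul_sum]
  refine Finset.sum_congr rfl fun j _ => ?_
  have hP : (∏ i ∈ Finset.univ.erase j, (∑ l, C (a i l) * X ^ (d l) : ℝ[X]).eval x)
      = (∏ i, (∑ l, C (a i l) * X ^ (d l) : ℝ[X]).eval x) / (∑ l, C (a j l) * X ^ (d l) : ℝ[X]).eval x := by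
    rw [eq_div_iff (hpole j), Finset.prod_erase_mul _ _ (Finset.mem_univ j)]
  rw [hP]
  ring

/-! ### §3 The window law -/

/-- ★★ **EVERY-`K` WINDOW LAW AT A NEAR-END COUPLING.**  Rows split-signed around `l₀`; every exponent below `d_{l₀}` equals `d_{l₀} − g`
(`g > 0`); some exponent lies above `d_{l₀}`; a window `[u,v] ⊂ (0,∞)` on which every row keeps a constant sign; and on `[u,v]` every UPPER
letter-fraction sum is negative: `Σ_j a_{jl}·x^{d_{l₀}}/f_j(x) < 0` for all `l` with `d_{l₀} < d_l`.  Then the c-free Euler numerator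
`R_{l₀}` has at most one zero in `[u,v]`. [this file's theorem] -/
theorem eulerNumeratorK_roots_Icc_le_one_of_upperSums_neg {m K : ℕ} (d : Fin K → ℕ) (a : Fin m → Fin K → ℝ) (l₀ : Fin K)
    (hlow : ∀ j l, d l < d l₀ → 0 ≤ a j l) (hup : ∀ j l, d l₀ < d l → a j l ≤ 0)
    (g : ℕ) (hg : 0 < g) (hgap : ∀ l, d l < d l₀ → d l + g = d l₀) (htop : ∃ l, d l₀ < d l)
    {u v : ℝ} (hu : 0 < u)
    (hsign : ∀ j, (∀ x ∈ Set.Icc u v, 0 < (∑ l, C (a j l) * X ^ (d l) : ℝ[X]).eval x) ∨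
      (∀ x ∈ Set.Icc u v, (∑ l, C (a j l) * X ^ (d l) : ℝ[X]).eval x < 0))
    (hA : ∀ x ∈ Set.Icc u v, ∀ l, d l₀ < d l →
      ∑ j, a j l * (x ^ (d l₀) / (∑ l', C (a j l') * X ^ (d l') : ℝ[X]).eval x) < 0) :
    ((∑ j, (∑ l, C (a j l * ((d l : ℝ) - d l₀)) * X ^ (d l)) * ∏ i ∈ Finset.univ.erase j, (∑ l, C (a i l) * X ^ (d l))
        : ℝ[X]).roots.toFinset.filter (fun t => u ≤ t ∧ t ≤ v)).card ≤ 1 := by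
  classical
  -- shorthand: rows, inverse reduced rows, letter-fraction sums, and the straightened Euler sum `Ξ`
  set f : Fin m → ℝ[X] := fun j => ∑ l, C (a j l) * X ^ (d l) with hf
  set T : Fin m → ℝ → ℝ := fun j x => x ^ (d l₀) / (f j).eval x with hT
  set A : Fin K → ℝ → ℝ := fun l x => ∑ j, a j l * T j x with hAdef
  set Ξ : ℝ → ℝ := fun x => ∑ l, ((d l : ℝ) - d l₀) * x ^ (d l + g - d l₀) * A l x with hΞ
  have hpole : ∀ x ∈ Set.Icc u v, ∀ j, (f j).eval x ≠ 0 := by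
    intro x hx j
    rcases hsign j with h | h
    · exact (h x hx).ne'
    · exact (h x hx).ne
  -- (1) monotonicity of the letter-fraction sums
  have hTmono : ∀ j, MonotoneOn (T j) (Set.Icc u v) := fun j =>
    inv_row_monotone_of_splitSigned d (a j) l₀ (hlow j) (hup j) hu (hsign j)
  have hAlow : ∀ l, d l < d l₀ → MonotoneOn (A l) (Set.Icc u v) := by
    intro l hl x hx y hy hxy
    exact Finset.sum_le_sum fun j _ => mul_le_mul_of_nonneg_left (hTmono j hx hy hxy) (hlow j l hl)
  have hAup : ∀ l, d l₀ < d l → AntitoneOn (A l) (Set.Icc u v) := by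
    intro l hl x hx y hy hxy
    exact Finset.sum_le_sum fun j _ => mul_le_mul_of_nonpos_left (hTmono j hx hy hxy) (hup j l hl)
  -- (2) `Ξ` is strictly antitone on the window
  have hterm : ∀ x ∈ Set.Icc u v, ∀ y ∈ Set.Icc u v, x < y → ∀ l,
      ((d l : ℝ) - d l₀) * y ^ (d l + g - d l₀) * A l y ≤ ((d l : ℝ) - d l₀) * x ^ (d l + g - d l₀) * A l x := by
    intro x hx y hy hxy l
    have hx0 : 0 < x := hu.trans_le hx.1
    rcases lt_trichotomy (d l) (d l₀) with h | h | h
    · -- lower letter: exponent `0`, coefficient `−g`, `A l` isotone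
      have he : d l + g - d l₀ = 0 := by have := hgap l h; omega
      have hc : ((d l : ℝ) - d l₀) = -(g : ℝ) := by
        have := hgap l h
        have : ((d l : ℝ) + g) = d l₀ := by exact_mod_cast this
        linarith
      rw [he, hc]
      simp only [pow_zero, mul_one]
      have := hAlow l h hx hy hxy.le
      have hg0 : -(g : ℝ) ≤ 0 := by simp
      exact mul_le_mul_of_nonpos_left this hg0
    · rw [h, sub_self, zero_mul, zero_mul, zero_mul, zero_mul]
    · -- upper letter: positive coefficient and exponent, `A l` antitone and NEGATIVE
      have hc : 0 < ((d l : ℝ) - d l₀) := by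
        have : (d l₀ : ℝ) < d l := by exact_mod_cast h
        linarith
      have he : 0 < d l + g - d l₀ := by omega
      have hAy : A l y ≤ A l x := hAup l h hx hy hxy.le
      have hAx : A l x < 0 := hA x hx l h
      have hpow : x ^ (d l + g - d l₀) < y ^ (d l + g - d l₀) := pow_lt_pow_left₀ hxy hx0.le he.ne'
      have hpowy : 0 < y ^ (d l + g - d l₀) := pow_pos (hx0.trans hxy) _
      have step1 : y ^ (d l + g - d l₀) * A l y ≤ y ^ (d l + g - d l₀) * A l x := mul_le_mul_of_nonneg_left hAy hpowy.le
      have step2 : y ^ (d l + g - d l₀) * A l x < x ^ (d l + g - d l₀) * A l x := mul_lt_mul_of_neg_right hpow hAx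
      have := mul_le_mul_of_nonneg_left (step1.trans step2.le) hc.le
      linarith [this]
  obtain ⟨lt, hlt⟩ := htop
  have hstrict : ∀ x ∈ Set.Icc u v, ∀ y ∈ Set.Icc u v, x < y →
      ((d lt : ℝ) - d l₀) * y ^ (d lt + g - d l₀) * A lt y < ((d lt : ℝ) - d l₀) * x ^ (d lt + g - d l₀) * A lt x := by
    intro x hx y hy hxy
    have hx0 : 0 < x := hu.trans_le hx.1
    have hc : 0 < ((d lt : ℝ) - d l₀) := by
      have : (d l₀ : ℝ) < d lt := by exact_mod_cast hlt
      linarith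
    have he : 0 < d lt + g - d l₀ := by omega
    have hAy : A lt y ≤ A lt x := hAup lt hlt hx hy hxy.le
    have hAx : A lt x < 0 := hA x hx lt hlt
    have hpow : x ^ (d lt + g - d l₀) < y ^ (d lt + g - d l₀) := pow_lt_pow_left₀ hxy hx0.le he.ne'
    have hpowy : 0 < y ^ (d lt + g - d l₀) := pow_pos (hx0.trans hxy) _
    have step1 : y ^ (d lt + g - d l₀) * A lt y ≤ y ^ (d lt + g - d l₀) * A lt x := mul_le_mul_of_nonneg_left hAy hpowy.le
    have step2 : y ^ (d lt + g - d l₀) * A lt x < x ^ (d lt + g - d l₀) * A lt x := mul_lt_mul_of_neg_right hpow hAx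
    have := mul_lt_mul_of_pos_left (step1.trans_lt step2) hc
    linarith [this]
  have hΞanti : ∀ x ∈ Set.Icc u v, ∀ y ∈ Set.Icc u v, x < y → Ξ y < Ξ x := by
    intro x hx y hy hxy
    simp only [hΞ]
    rw [← Finset.add_sum_erase _ _ (Finset.mem_univ lt), ← Finset.add_sum_erase _ _ (Finset.mem_univ lt)]
    exact add_lt_add_of_lt_of_le (hstrict x hx y hy hxy)
      (Finset.sum_le_sum fun l _ => hterm x hx y hy hxy l)
  -- (3) at a root `t` in the window, `Ξ t = 0`
  have hΞ_eq : ∀ x ∈ Set.Icc u v, Ξ x = x ^ g *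
      ∑ j, (∑ l, C (a j l * ((d l : ℝ) - d l₀)) * X ^ (d l) : ℝ[X]).eval x / (f j).eval x := by
    intro x hx
    simp only [hΞ, hAdef, hT]
    -- expand the Euler letters and swap the sums
    have hB : ∀ j, (∑ l, C (a j l * ((d l : ℝ) - d l₀)) * X ^ (d l) : ℝ[X]).eval x
        = ∑ l, a j l * ((d l : ℝ) - d l₀) * x ^ (d l) := fun j => eulerLetter_eval d (a j) l₀ x
    simp_rw [hB, Finset.sum_div, Finset.mul_sum]
    rw [Finset.sum_comm]
    refine Finset.sum_congr rfl fun j _ => ?_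
    refine Finset.sum_congr rfl fun l _ => ?_
    -- `x^g · x^{d l} = x^{d l + g − d l₀} · x^{d l₀}` (valid: no exponent lies strictly between `d l₀ − g` and `d l₀`)
    have hdl : d l₀ ≤ d l + g := by
      rcases lt_or_ge (d l) (d l₀) with h | h
      · have := hgap l h; omega
      · omega
    have hxpow : x ^ g * x ^ (d l) = x ^ (d l + g - d l₀) * x ^ (d l₀) := by
      rw [← pow_add, ← pow_add]; congr 1; omega
    rw [show x ^ g * (a j l * ((d l : ℝ) - d l₀) * x ^ (d l) / (f j).eval x)
        = a j l * ((d l : ℝ) - d l₀) * (x ^ g * x ^ (d l)) / (f j).eval x by ring, hxpow]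
    ring
  have hroot : ∀ t, t ∈ ((∑ j, (∑ l, C (a j l * ((d l : ℝ) - d l₀)) * X ^ (d l)) *
      ∏ i ∈ Finset.univ.erase j, (∑ l, C (a i l) * X ^ (d l)) : ℝ[X]).roots.toFinset.filter (fun t => u ≤ t ∧ t ≤ v)) → Ξ t = 0 := by
    intro t ht
    rw [Finset.mem_filter, Multiset.mem_toFinset] at ht
    obtain ⟨hrt, htI⟩ := ht
    have htI' : t ∈ Set.Icc u v := htI
    have ht0 : 0 < t := hu.trans_le htI.1
    have hev := (mem_roots (ne_zero_of_mem_roots hrt)).mp hrt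
    have hev' := hev
    rw [IsRoot.def, eulerNumeratorK_eval_eq_prod_mul_sum d a l₀ (hpole t htI')] at hev'
    have hP : (∏ i, (∑ l, C (a i l) * X ^ (d l) : ℝ[X]).eval t) ≠ 0 :=
      Finset.prod_ne_zero_iff.mpr fun i _ => hpole t htI' i
    have hsum := (mul_eq_zero.mp hev').resolve_left hP
    rw [hΞ_eq t htI', hsum, mul_zero]
  -- (4) conclude
  rw [Finset.card_le_one]
  intro t₁ ht₁ t₂ ht₂
  have h1 := hroot t₁ ht₁
  have h2 := hroot t₂ ht₂
  have ht₁I : t₁ ∈ Set.Icc u v := (Finset.mem_filter.mp ht₁).2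
  have ht₂I : t₂ ∈ Set.Icc u v := (Finset.mem_filter.mp ht₂).2
  by_contra hne
  rcases lt_or_gt_of_ne hne with h | h
  · have := hΞanti t₁ ht₁I t₂ ht₂I h; linarith
  · have := hΞanti t₂ ht₂I t₁ ht₁I h; linarith

end ProductPlusOne

end Summit.ValiantsHypothesis.ValiantsHypothesis.Theorems.LacunarySymmetroidMatrixDescartes
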